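import Literature.Geometry.Riemannian.TwistorBundle
import HarnessLib

/-!
# The twistor bundle: smoothness of the projection, the trivialisations and the antipodal map
(topic `Geometry/Riemannian`; support for `exists_twistorSpace`, `TwistorPackage.lean`)

Continuing `TwistorBundle.lean` (the total space `Z = twistorTotal g hg o` of the twistor bundle
of an oriented Riemannian 4-manifold as a `C^∞` 6-manifold), we prove that the local
trivialisations `Z ⊇ π⁻¹(U) → U × S²` are smooth with smooth inverses (they are the identity in
the charts of `Z`, which were defined through them), and derive: the projection `π : Z → M` is a
smooth surjective submersion with fibres homeomorphic to `S²`; the fibrewise antipodal map `τ` is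
a smooth free involution over `M`; and over the domain `U` of every twistor frame the
trivialisation is a diffeomorphism `π⁻¹(U) ≅ U × S²` intertwining `τ` with `id × (antipodal map)`
(Atiyah–Hitchin–Singer 1978, §4; Besse 1987, 13.44, 13.63).

Everything here is proved; no named facts are introduced.

## References

* M. F. Atiyah, N. J. Hitchin, I. M. Singer, *Self-duality in four-dimensional Riemannian
  geometry*, Proc. R. Soc. A 362 (1978), §4. [AtiyahHitchinSinger1978]
* A. L. Besse, *Einstein Manifolds* (1987), 13.44, 13.63. [Besse1987]
-/

noncomputable section

open scoped Manifold ContDiff Matrix BigOperators Topology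
open Bundle Set Filter Module Function

namespace Literature.Geometry.Riemannian

open Literature.Geometry.Lorentzian (PseudoRiemannianMetric)
open Literature.Geometry.Lorentzian.PseudoRiemannianMetric
open Literature.Topology.FourManifolds (SmoothOrientation)
open Literature.Topology.FourManifolds

/-- Local notation: the model space `ℝ⁴`. -/
local notation "E4" => EuclideanSpace ℝ (Fin 4)
/-- Local notation: `ℝ³`, the ambient space of the fibre sphere. -/
local notation "E3" => EuclideanSpace ℝ (Fin 3)
/-- Local notation: `ℝ²`, the model of the fibre sphere. -/
local notation "E2" => EuclideanSpace ℝ (Fin 2)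
/-- Local notation: `ℝ⁶`, the model of the total space. -/
local notation "E6" => EuclideanSpace ℝ (Fin 6)
/-- Local notation: the unit 2-sphere in `ℝ³`, with its analytic manifold structure `𝓡 2`. -/
local notation "𝕊²" => (Metric.sphere (0 : EuclideanSpace ℝ (Fin 3)) 1)

variable {M : Type*} [TopologicalSpace M] [ChartedSpace (EuclideanSpace ℝ (Fin 4)) M]
  [IsManifold (𝓡 4) ∞ M]
  (g : PseudoRiemannianMetric (𝓡 4) ∞ E4 (TangentSpace (𝓡 4) : M → Type _))
  (hg : g.IsRiemannian) (o : SmoothOrientation (𝓡 4) M)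

/-! ### The local trivialisations are smooth with smooth inverse -/

/-- The chart of the `ℝ⁶`-atlas of `Z` built from the trivialisation of the frame `F` and the
preferred chart of `M × S²` at `p`. [folklore] -/
def trivChart (F : TwistorFrame g o) (p : M × 𝕊²) : OpenPartialHomeomorph (twistorTotal g hg o) E6 :=
  (((twistorCore g hg o).localTriv F).toOpenPartialHomeomorph ≫ₕ chartAt (ModelProd E4 E2) p) ≫ₕ
    prodChartSix

/-- The charts `trivChart` belong to the atlas of `Z`. [folklore] -/
theorem trivChart_mem_atlas (F : TwistorFrame g o) (p : M × 𝕊²) :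
    trivChart g hg o F p ∈ atlas E6 (twistorTotal g hg o) := by
  rw [twistorTotal.mem_atlas_iff]
  refine ⟨_, ?_, rfl⟩
  rw [twistorTotal.mem_atlas_prod_iff]
  exact ⟨F, chartAt E4 p.1, chart_mem_atlas E4 p.1, chartAt E2 p.2, chart_mem_atlas E2 p.2, rfl⟩

/-- **The local trivialisations of the twistor bundle are smooth** (`Z ⊇ π⁻¹(U) → M × S²`): read
in the chart `trivChart F (T z)` of `Z` and the chart of `M × S²` at `T z`, the trivialisation `T`
is the identity. [cite: AtiyahHitchinSinger1978, §4] -/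
theorem contMDiffAt_localTriv (F : TwistorFrame g o) {z : twistorTotal g hg o}
    (hz : z ∈ ((twistorCore g hg o).localTriv F).source) :
    ContMDiffAt (𝓡 6) ((𝓡 4).prod (𝓡 2)) ∞ ((twistorCore g hg o).localTriv F) z := by
  set T := (twistorCore g hg o).localTriv F with hT
  set c : OpenPartialHomeomorph (M × 𝕊²) (ModelProd E4 E2) := chartAt (ModelProd E4 E2) (T z)
    with hc
  have hcz : T z ∈ c.source := mem_chart_source _ _
  have he : trivChart g hg o F (T z) ∈ IsManifold.maximalAtlas (𝓡 6) ∞ (twistorTotal g hg o) :=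
    IsManifold.subset_maximalAtlas (trivChart_mem_atlas g hg o F (T z))
  have hcA : c ∈ IsManifold.maximalAtlas ((𝓡 4).prod (𝓡 2)) ∞ (M × 𝕊²) :=
    IsManifold.chart_mem_maximalAtlas _
  have hze : z ∈ (trivChart g hg o F (T z)).source := by
    simp only [trivChart, OpenPartialHomeomorph.trans_source, mem_inter_iff, mem_preimage,
      OpenPartialHomeomorph.coe_trans, Function.comp_apply, prodChartSix_source, mem_univ,
      and_true, Trivialization.coe_coe]
    exact ⟨hz, hcz⟩
  refine (contMDiffWithinAt_iff_of_mem_maximalAtlas (s := univ) he hcA hze hcz).2 ⟨?_, ?_⟩ |>.contMDiffAt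
    univ_mem
  · exact (T.continuousOn_toFun.continuousAt (T.open_source.mem_nhds hz)).continuousWithinAt
  · -- the written map is `prodEquivSix⁻¹` near the point
    have hsm : ContDiffWithinAt ℝ ∞ (fun q : E6 ↦ ((prodEquivSix.symm q : E4 × E2)))
        (((trivChart g hg o F (T z)).extend (𝓡 6)).symm ⁻¹' univ ∩ range (𝓡 6))
        ((trivChart g hg o F (T z)).extend (𝓡 6) z) :=
      prodEquivSix.symm.contDiff.contDiffAt.contDiffWithinAt
    refine hsm.congr_of_eventuallyEq_of_mem ?_ ⟨mem_univ _, mem_range_self _⟩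
    have hopen : IsOpen ((trivChart g hg o F (T z)).target) := OpenPartialHomeomorph.open_target _
    have hzt : (trivChart g hg o F (T z)).extend (𝓡 6) z ∈ (trivChart g hg o F (T z)).target := by
      rw [OpenPartialHomeomorph.extend_coe, Function.comp_apply, modelWithCornersSelf_coe, id_eq]
      exact OpenPartialHomeomorph.map_source _ hze
    filter_upwards [mem_nhdsWithin_of_mem_nhds (hopen.mem_nhds hzt)] with q hq
    -- unpack `q ∈ target`
    have hq' := hq
    simp only [trivChart, OpenPartialHomeomorph.trans_target, mem_inter_iff, mem_preimage,
      prodChartSix_target, mem_univ, true_and, prodChartSix_symm_apply] at hq'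
    obtain ⟨hq1, hq2⟩ := hq'
    simp only [Function.comp_apply, OpenPartialHomeomorph.extend_coe,
      OpenPartialHomeomorph.extend_coe_symm, modelWithCornersSelf_coe_symm, id_eq, trivChart,
      OpenPartialHomeomorph.coe_trans_symm, prodChartSix_symm_apply]
    rw [← hT, ← hc, T.apply_symm_apply hq2, c.right_inv hq1]
    rfl

/-- **The inverse local trivialisations are smooth** (`M × S² ⊇ U × S² → Z`): read in the chart
of `M × S²` at `p` and the chart `trivChart F p` of `Z` at `T⁻¹ p`, the inverse trivialisation is
the identity. [cite: AtiyahHitchinSinger1978, §4] -/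
theorem contMDiffAt_localTriv_symm (F : TwistorFrame g o) {p : M × 𝕊²}
    (hp : p ∈ ((twistorCore g hg o).localTriv F).target) :
    ContMDiffAt ((𝓡 4).prod (𝓡 2)) (𝓡 6) ∞
      ((twistorCore g hg o).localTriv F).toOpenPartialHomeomorph.symm p := by
  set T := (twistorCore g hg o).localTriv F with hT
  set c : OpenPartialHomeomorph (M × 𝕊²) (ModelProd E4 E2) := chartAt (ModelProd E4 E2) p with hc
  have hcp : p ∈ c.source := mem_chart_source _ _
  have he : trivChart g hg o F p ∈ IsManifold.maximalAtlas (𝓡 6) ∞ (twistorTotal g hg o) :=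
    IsManifold.subset_maximalAtlas (trivChart_mem_atlas g hg o F p)
  have hcA : c ∈ IsManifold.maximalAtlas ((𝓡 4).prod (𝓡 2)) ∞ (M × 𝕊²) :=
    IsManifold.chart_mem_maximalAtlas _
  have hsrc : T.toOpenPartialHomeomorph.symm p ∈ (trivChart g hg o F p).source := by
    simp only [trivChart, OpenPartialHomeomorph.trans_source, mem_inter_iff, mem_preimage,
      OpenPartialHomeomorph.coe_trans, Function.comp_apply, prodChartSix_source, mem_univ,
      and_true, Trivialization.coe_coe]
    rw [← hT, T.apply_symm_apply hp]
    exact ⟨T.map_target hp, hcp⟩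
  refine (contMDiffWithinAt_iff_of_mem_maximalAtlas (s := univ) hcA he hcp hsrc).2 ⟨?_, ?_⟩
    |>.contMDiffAt univ_mem
  · exact (T.toOpenPartialHomeomorph.continuousOn_symm.continuousAt
      (T.open_target.mem_nhds hp)).continuousWithinAt
  · have hsm : ContDiffWithinAt ℝ ∞ (fun q : E4 × E2 ↦ (prodEquivSix q : E6))
        ((c.extend ((𝓡 4).prod (𝓡 2))).symm ⁻¹' univ ∩ range ((𝓡 4).prod (𝓡 2)))
        (c.extend ((𝓡 4).prod (𝓡 2)) p) :=
      prodEquivSix.contDiff.contDiffAt.contDiffWithinAt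
    refine hsm.congr_of_eventuallyEq_of_mem ?_ ⟨mem_univ _, mem_range_self _⟩
    have hopen : IsOpen (c.target ∩ c.symm ⁻¹' T.target) :=
      c.isOpen_inter_preimage_symm T.open_target
    have hpt : c.extend ((𝓡 4).prod (𝓡 2)) p ∈ c.target ∩ c.symm ⁻¹' T.target := by
      rw [OpenPartialHomeomorph.extend_coe, Function.comp_apply]
      refine ⟨?_, ?_⟩
      · exact c.map_source hcp
      · rw [mem_preimage]
        have : c.symm (((𝓡 4).prod (𝓡 2)) (c p)) = p := c.left_inv hcp
        rw [this]; exact hp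
    filter_upwards [mem_nhdsWithin_of_mem_nhds (hopen.mem_nhds hpt)] with q hq
    obtain ⟨hq1, hq2⟩ := hq
    rw [mem_preimage] at hq2
    simp only [Function.comp_apply, OpenPartialHomeomorph.extend_coe,
      OpenPartialHomeomorph.extend_coe_symm, trivChart, OpenPartialHomeomorph.coe_trans,
      prodChartSix_apply, Trivialization.coe_coe, modelWithCornersSelf_coe, id_eq]
    congr 1
    have h1 : ((𝓡 4).prod (𝓡 2)).symm q = q := rfl
    rw [h1, ← hT, T.apply_symm_apply hq2, ← hc, c.right_inv hq1]

/-- The local trivialisations are smooth on their source. [cite: AtiyahHitchinSinger1978, §4] -/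
theorem contMDiffOn_localTriv (F : TwistorFrame g o) :
    ContMDiffOn (𝓡 6) ((𝓡 4).prod (𝓡 2)) ∞ ((twistorCore g hg o).localTriv F)
      ((twistorCore g hg o).localTriv F).source := fun _ hz ↦
  (contMDiffAt_localTriv g hg o F hz).contMDiffWithinAt

/-- The inverse local trivialisations are smooth on their source. [cite: AtiyahHitchinSinger1978, §4] -/
theorem contMDiffOn_localTriv_symm (F : TwistorFrame g o) :
    ContMDiffOn ((𝓡 4).prod (𝓡 2)) (𝓡 6) ∞
      ((twistorCore g hg o).localTriv F).toOpenPartialHomeomorph.symm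
      ((twistorCore g hg o).localTriv F).target := fun _ hp ↦
  (contMDiffAt_localTriv_symm g hg o F hp).contMDiffWithinAt

/-! ### The projection -/

/-- **The projection of the twistor bundle is smooth.** [cite: AtiyahHitchinSinger1978, §4] -/
theorem contMDiff_twistorProj : ContMDiff (𝓡 6) (𝓡 4) ∞ (twistorProj g hg o) := fun z ↦ by
  set T := (twistorCore g hg o).localTrivAt z.proj with hT
  have hz : z ∈ T.source := (twistorCore g hg o).mem_localTrivAt_source z z.proj |>.2
    ((twistorCore g hg o).mem_baseSet_at z.proj)
  have h1 : ContMDiffAt (𝓡 6) ((𝓡 4).prod (𝓡 2)) ∞ T z := contMDiffAt_localTriv g hg o _ hz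
  have h2 : ContMDiffAt (𝓡 6) (𝓡 4) ∞ (Prod.fst ∘ T) z := contMDiffAt_fst.comp z h1
  refine h2.congr_of_eventuallyEq ?_
  filter_upwards [T.open_source.mem_nhds hz] with z' hz'
  exact (T.coe_fst hz').symm

/-- The projection of the twistor bundle is onto. [folklore] -/
theorem twistorProj_surjective : Function.Surjective (twistorProj g hg o) := fun x ↦
  ⟨⟨x, (⟨EuclideanSpace.single 0 1, by simp⟩ : 𝕊²)⟩, rfl⟩

/-- The fibres of the twistor bundle are 2-spheres. [cite: AtiyahHitchinSinger1978, §4] -/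
theorem nonempty_fiber_homeomorph (x : M) :
    Nonempty (↥(twistorProj g hg o ⁻¹' {x}) ≃ₜ 𝕊²) :=
  ⟨((twistorCore g hg o).localTrivAt x).preimageSingletonHomeomorph
    ((twistorCore g hg o).mem_baseSet_at x)⟩

/-- The differential of a local trivialisation is onto (the trivialisation has a smooth local
inverse). [folklore] -/
theorem mfderiv_localTriv_surjective (F : TwistorFrame g o) {z : twistorTotal g hg o}
    (hz : z ∈ ((twistorCore g hg o).localTriv F).source) :
    Function.Surjective (mfderiv (𝓡 6) ((𝓡 4).prod (𝓡 2)) ((twistorCore g hg o).localTriv F) z) := by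
  set T := (twistorCore g hg o).localTriv F with hT
  have hTz : T z ∈ T.target := T.map_source hz
  have hd : MDifferentiableAt (𝓡 6) ((𝓡 4).prod (𝓡 2)) T z :=
    (contMDiffAt_localTriv g hg o F hz).mdifferentiableAt (by simp)
  have hd' : MDifferentiableAt ((𝓡 4).prod (𝓡 2)) (𝓡 6) T.toOpenPartialHomeomorph.symm (T z) :=
    (contMDiffAt_localTriv_symm g hg o F hTz).mdifferentiableAt (by simp)
  have hzz : T.toOpenPartialHomeomorph.symm (T z) = z := T.symm_apply_apply hz
  have hcomp : mfderiv ((𝓡 4).prod (𝓡 2)) ((𝓡 4).prod (𝓡 2)) (T ∘ T.toOpenPartialHomeomorph.symm) (T z) =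
      (mfderiv (𝓡 6) ((𝓡 4).prod (𝓡 2)) T z).comp
        (mfderiv ((𝓡 4).prod (𝓡 2)) (𝓡 6) T.toOpenPartialHomeomorph.symm (T z)) := by
    rw [← hzz] at hd
    rw [mfderiv_comp (T z) hd hd', hzz]
  have hid : mfderiv ((𝓡 4).prod (𝓡 2)) ((𝓡 4).prod (𝓡 2)) (T ∘ T.toOpenPartialHomeomorph.symm) (T z) =
      ContinuousLinearMap.id ℝ _ := by
    have heq : (T ∘ T.toOpenPartialHomeomorph.symm) =ᶠ[𝓝 (T z)] id := by
      filter_upwards [T.open_target.mem_nhds hTz] with p hp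
      exact T.apply_symm_apply hp
    rw [heq.mfderiv_eq, mfderiv_id]
  intro w
  refine ⟨mfderiv ((𝓡 4).prod (𝓡 2)) (𝓡 6) T.toOpenPartialHomeomorph.symm (T z) w, ?_⟩
  have := congrArg (fun f : TangentSpace ((𝓡 4).prod (𝓡 2)) (T z) →L[ℝ]
    TangentSpace ((𝓡 4).prod (𝓡 2)) (T z) ↦ f w) (hcomp.symm.trans hid)
  exact this

/-- **The projection of the twistor bundle is a submersion.** [cite: AtiyahHitchinSinger1978, §4] -/
theorem mfderiv_twistorProj_surjective (z : twistorTotal g hg o) :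
    Function.Surjective (mfderiv (𝓡 6) (𝓡 4) (twistorProj g hg o) z) := by
  set T := (twistorCore g hg o).localTrivAt z.proj with hT
  have hz : z ∈ T.source := (twistorCore g hg o).mem_localTrivAt_source z z.proj |>.2
    ((twistorCore g hg o).mem_baseSet_at z.proj)
  have hd : MDifferentiableAt (𝓡 6) ((𝓡 4).prod (𝓡 2)) T z :=
    (contMDiffAt_localTriv g hg o _ hz).mdifferentiableAt (by simp)
  have heq : twistorProj g hg o =ᶠ[𝓝 z] Prod.fst ∘ T := by
    filter_upwards [T.open_source.mem_nhds hz] with z' hz'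
    exact (T.coe_fst hz').symm
  rw [heq.mfderiv_eq, mfderiv_comp z mdifferentiableAt_fst hd]
  have hA : Function.Surjective
      (mfderiv ((𝓡 4).prod (𝓡 2)) (𝓡 4) (Prod.fst : M × 𝕊² → M) (T z)) := fun v ↦
    ⟨(v, 0), by rw [mfderiv_fst]; rfl⟩
  have hB := mfderiv_localTriv_surjective g hg o _ hz
  have hcomp : Function.Surjective
      (⇑(mfderiv ((𝓡 4).prod (𝓡 2)) (𝓡 4) (Prod.fst : M × 𝕊² → M) (T z)) ∘
        ⇑(mfderiv (𝓡 6) ((𝓡 4).prod (𝓡 2)) T z)) := hA.comp hB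
  exact hcomp

/-! ### The antipodal map -/

variable {g o} in
/-- The coordinate changes commute with the antipodal map of the sphere (they are linear).
[folklore] -/
theorem twistorCoordChange_neg (F F' : TwistorFrame g o) (x : M) (ζ : 𝕊²) :
    twistorCoordChange F F' x (-ζ) = -twistorCoordChange F F' x ζ := by
  by_cases h : x ∈ F.U ∧ x ∈ F'.U
  · ext1
    rw [coe_neg_sphere, coe_twistorCoordChange h.1 h.2, coe_twistorCoordChange h.1 h.2,
      coe_neg_sphere, WithLp.ofLp_neg, map_neg, WithLp.toLp_neg]
  · rw [twistorCoordChange, dif_neg h, twistorCoordChange, dif_neg h]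

/-- **The fibrewise antipodal map `τ`** of the twistor bundle: `⟨x, ζ⟩ ↦ ⟨x, -ζ⟩` in any (hence
every, `twistorCoordChange_neg`) trivialisation — `j ↦ -j` on complex structures
(Besse 1987, 13.63 (2)). [cite: Besse1987, 13.63] -/
def twistorTau (z : twistorTotal g hg o) : twistorTotal g hg o :=
  ⟨z.proj, (-(show 𝕊² from z.2) : 𝕊²)⟩

/-- `τ` preserves the fibres. [cite: Besse1987, 13.63] -/
@[simp] theorem twistorProj_twistorTau (z : twistorTotal g hg o) :
    twistorProj g hg o (twistorTau g hg o z) = twistorProj g hg o z := rfl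

/-- `τ` is an involution. [cite: Besse1987, 13.63] -/
theorem twistorTau_twistorTau (z : twistorTotal g hg o) :
    twistorTau g hg o (twistorTau g hg o z) = z := by
  cases z
  simp [twistorTau]

/-- `τ` has no fixed point. [cite: Besse1987, 13.63] -/
theorem twistorTau_ne (z : twistorTotal g hg o) : twistorTau g hg o z ≠ z := by
  obtain ⟨x, ζ⟩ := z
  change 𝕊² at ζ
  intro h
  have h2 : -ζ = ζ := by
    have := congrArg Bundle.TotalSpace.snd h
    simpa [twistorTau] using this
  have h3 : (ζ : E3) = 0 := by
    have h4 : -(ζ : E3) = (ζ : E3) := by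
      rw [← coe_neg_sphere]; exact congrArg Subtype.val h2
    have : (2 : ℝ) • (ζ : E3) = 0 := by rw [two_smul]; nth_rewrite 1 [← h4]; simp
    exact (smul_eq_zero.1 this).resolve_left two_ne_zero
  have h5 := norm_eq_of_mem_sphere ζ
  rw [h3, norm_zero] at h5
  exact zero_ne_one h5

/-- `τ` read in a local trivialisation is `id × (antipodal map)`. [cite: Besse1987, 13.63] -/
theorem localTriv_twistorTau (F : TwistorFrame g o) (z : twistorTotal g hg o) :
    (twistorCore g hg o).localTriv F (twistorTau g hg o z) =
      (((twistorCore g hg o).localTriv F z).1, -((twistorCore g hg o).localTriv F z).2) := by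
  rw [FiberBundleCore.localTriv_apply, FiberBundleCore.localTriv_apply]
  simp only [twistorTau, twistorCore_coordChange, Prod.mk.injEq, true_and]
  exact twistorCoordChange_neg _ _ _ _

/-- **`τ` is smooth**: near `z` it is `T⁻¹ ∘ (id × antipodal) ∘ T` for the trivialisation `T` at
`π z`. [cite: Besse1987, 13.63] -/
theorem contMDiff_twistorTau : ContMDiff (𝓡 6) (𝓡 6) ∞ (twistorTau g hg o) := fun z ↦ by
  set T := (twistorCore g hg o).localTriv ((twistorCore g hg o).indexAt z.proj) with hT
  have hz : z ∈ T.source := ((twistorCore g hg o).mem_localTriv_source _ z).2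
    ((twistorCore g hg o).mem_baseSet_at z.proj)
  have hA : ContMDiff ((𝓡 4).prod (𝓡 2)) ((𝓡 4).prod (𝓡 2)) ∞ (fun p : M × 𝕊² ↦ (p.1, -p.2)) :=
    contMDiff_fst.prodMk ((contMDiff_neg_sphere (n := 2)).comp contMDiff_snd)
  have hTz : (T z).1 ∈ T.baseSet := (T.mem_target).1 (T.map_source hz)
  have hAt : (fun p : M × 𝕊² ↦ (p.1, -p.2)) (T z) ∈ T.target := by
    rw [T.mem_target]; exact hTz
  have h1 : ContMDiffAt (𝓡 6) (𝓡 6) ∞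
      (T.toOpenPartialHomeomorph.symm ∘ (fun p : M × 𝕊² ↦ (p.1, -p.2)) ∘ T) z :=
    (contMDiffAt_localTriv_symm g hg o _ hAt).comp z
      ((hA _).comp z (contMDiffAt_localTriv g hg o _ hz))
  refine h1.congr_of_eventuallyEq ?_
  filter_upwards [T.open_source.mem_nhds hz] with z' hz'
  have hτ : twistorTau g hg o z' ∈ T.source := by
    rw [T.mem_source]; exact (T.mem_source).1 hz'
  simp only [Function.comp_apply]
  rw [hT, ← localTriv_twistorTau g hg o, Trivialization.symm_apply_apply _ hτ]

end Literature.Geometry.Riemannian
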